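import Literature.Barriers.HodgeConjecture.KaehlerCounterexamples
import Literature.Geometry.Kaehler.ComplexTorusKaehler
import Literature.AlgebraicGeometry.HodgeTheory.LefschetzOneOneProofs
import HarnessLib

/-!
# Barrier fact `Zucker1977_kaehlerTorus_noAnalyticCycles`: the cohomological half of Zucker's argument

Proof file (sibling of `Literature/Barriers/HodgeConjecture/KaehlerCounterexamples`). The barrier
fact `Literature.Barriers.HodgeConjecture.Zucker1977_kaehlerTorus_noAnalyticCycles` is S. Zucker,
*The Hodge conjecture for cubic fourfolds*, Compositio Math. 34 (1977), Appendix B, Theorem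
(p. 208) for `n = 1`, rendered as `Nonempty (ZuckerTorusWitness (Fin 2 → ℂ))`: a compact connected
Kähler surface with a non-zero integral class of type `(1,1)` and no analytic curve.

Zucker's printed argument (pp. 207–208) has two halves:

* (cohomology) on a `J`-torus `T = (ℂⁿ ⊕ ℂⁿ)/L`, `J(z, w) = (iz, -iw)`, `JL = L`, the classes
  `ξ = Re ω`, `η = Im ω`, `ω = a dz ∧ dw̄`, are integral of type `(n, n)` (Lemma, Mumford) and
  `J^*ω = i^{2n} ω`, so for `n` odd `J^*β = -β` on them;
* (geometry) "no effective analytic cycle can be homologous to zero on a compact Kähler manifold",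
  whence the general `J`-torus has no analytic subvariety of dimension `n` (Theorem).

This file PROVES the glue of the cohomological half in the form the tree can carry, for ANY
natural complex de Rham comparison family `e` (`ComplexDeRhamIsoFamily.IsNatural`): if a real
`C^∞` self-map `J` of `M` acts on `H²_dR(M; ℂ)` as an involution whose `(-1)`-eigenspace consists
of classes of type `(1,1)`, then for every INTEGRAL singular class `y` with `J^*y ≠ y` the class
`y - J^*y` is integral, non-zero and of type `(1,1)` in the sense of `IsOfTypeOnManifold`
(`exists_integral_ne_zero_isOfTypeOnManifold_of_involutive`): naturality transports the
eigenspace decomposition from de Rham to singular cohomology, so no normalisation of `e` (periods,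
integration) is needed. It also records

* `Zucker1977_kaehlerTorus_noAnalyticCycles.exists_complexDeRhamIsoFamily`: the fact, stated with
  the `∃ e`-convention of `IsOfTypeOnManifold`, IMPLIES de Rham's theorem with complex
  coefficients for manifolds charted on `ℂ²` (the named fact
  `Literature.NumberTheory.Transcendental.exists_complexDeRhamIsoFamily (Fin 2 → ℂ)`), so its
  discharge is downstream of that fact;
* `Zucker1977_kaehlerTorus_noAnalyticCycles.of_complexTorus`: the manifold half of the witness is
  the tree's complex torus `Literature.Geometry.Kaehler.ComplexTorus Φ` (`Φ : ℝ^ι ≃ ℂ²` a period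
  matrix), a compact connected Kähler surface (`ComplexTorusKaehler`); what remains is a class and
  the absence of analytic curves on one such torus.

## References

* S. Zucker, Compositio Math. 34 (1977) 199–209, Appendix B, Lemma and Proposition p. 207,
  Theorem p. 208 (numdam CM_1977__34_2_199_0, read 2026-08-15). [Zucker1977]
* H. Lange, Ch. Birkenhake, *Complex Abelian Varieties* (1992), §1.1 (complex tori, invariant
  forms). [LangeBirkenhake1992]
* A. Hatcher, *Algebraic Topology* (2002), §3.1 (integral classes, induced maps). [HatcherAT2002]
-/

noncomputable section

open scoped Manifold ContDiff Topology

universe u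

namespace Literature.Barriers.HodgeConjecture

open Literature.AlgebraicGeometry.HodgeTheory Literature.AlgebraicTopology.SingularHomology
  Literature.NumberTheory.Transcendental Literature.Geometry.Kaehler

/-! ### The fact implies de Rham's theorem (complex coefficients, model `ℂ²`) -/

/-- The barrier fact implies de Rham's theorem with complex coefficients for manifolds charted on
`ℂ²` (the named fact `exists_complexDeRhamIsoFamily (Fin 2 → ℂ)`): the type-`(1,1)` clause of the
witness is stated with the `∃ e`-convention of `IsOfTypeOnManifold`, which contains a natural
complex de Rham comparison family. Hence the discharge of the fact is downstream of de Rham's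
theorem. [cite: Zucker1977, Appendix B Lemma p. 207] -/
theorem Zucker1977_kaehlerTorus_noAnalyticCycles.exists_complexDeRhamIsoFamily
    (h : Zucker1977_kaehlerTorus_noAnalyticCycles) :
    exists_complexDeRhamIsoFamily (Fin 2 → ℂ) := by
  obtain ⟨W⟩ := h
  letI := W.topologicalSpace; letI := W.chartedSpace; letI := W.isManifold_real
  letI := W.t2Space; letI := W.compactSpace
  obtain ⟨e, he, -⟩ := W.isOfType
  exact ⟨e, he⟩

/-! ### Naturality transports eigenspaces of a self-map from de Rham to singular cohomology -/

section Transport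

variable {E : Type u} [NormedAddCommGroup E] [NormedSpace ℂ E]
variable {M : Type u} [TopologicalSpace M] [ChartedSpace E M] [IsManifold 𝓘(ℝ, E) ∞ M]
  [T2Space M] [SigmaCompactSpace M]

/-- **Eigenclasses of a smooth self-map are of type `(p, q)` when the de Rham eigenclasses are.**
Let `e` be a natural complex de Rham comparison family and `J : M → M` real `C^∞`. If every class
`x ∈ Hᵏ_dR(M; ℂ)` with `J^*x = a x` lies in `H^{p,q}`, then every singular class `c` with
`J^*c = a c` is of type `(p, q)` (`IsOfTypeOnManifold`): `e` intertwines the two pull-backs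
(`ComplexDeRhamIsoFamily.IsNatural`), so `e⁻¹ c` is again an `a`-eigenclass. This is how Zucker's
`J^*β = -β` (Appendix B, p. 208) is used without normalising `e`.
[cite: Zucker1977, Appendix B p. 208] -/
theorem IsOfTypeOnManifold.of_map_eq_smul {e : ComplexDeRhamIsoFamily E} (he : e.IsNatural)
    {J : M → M} (hJ : ContMDiff 𝓘(ℝ, E) 𝓘(ℝ, E) ∞ J) {k p q : ℕ} (a : ℂ)
    (hH : ∀ x : complexDeRhamCohomology E M k,
      complexDeRhamCohomology.map E hJ k x = a • x → x ∈ hodgePQ E M k p q)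
    {c : singularCohomology ℂ ℂ M k}
    (hc : singularCohomology.map ℂ ℂ ⟨J, hJ.continuous⟩ k c = a • c) :
    IsOfTypeOnManifold (E := E) k p q c := by
  refine ⟨e, he, (e M k).symm c, hH _ ((e M k).injective ?_), (e M k).apply_symm_apply c⟩
  rw [he M M J hJ k, LinearEquiv.apply_symm_apply, hc, map_smul, LinearEquiv.apply_symm_apply]

/-- **An identity between pull-backs transports from de Rham to singular cohomology**: if
`J^* ∘ J^* = id` on `Hᵏ_dR(M; ℂ)` then `J^* ∘ J^* = id` on `Hᵏ(M; ℂ)` (naturality of `e` and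
surjectivity of `e_M`). For Zucker's `J`, `J² = -1` on `V`, which acts trivially on even forms.
[cite: Zucker1977, Appendix B p. 208] -/
theorem singularCohomology_map_map_of_deRham {e : ComplexDeRhamIsoFamily E} (he : e.IsNatural)
    {J : M → M} (hJ : ContMDiff 𝓘(ℝ, E) 𝓘(ℝ, E) ∞ J) {k : ℕ}
    (h : ∀ x : complexDeRhamCohomology E M k,
      complexDeRhamCohomology.map E hJ k (complexDeRhamCohomology.map E hJ k x) = x)
    (c : singularCohomology ℂ ℂ M k) :
    singularCohomology.map ℂ ℂ ⟨J, hJ.continuous⟩ k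
      (singularCohomology.map ℂ ℂ ⟨J, hJ.continuous⟩ k c) = c := by
  obtain ⟨x, rfl⟩ := (e M k).surjective c
  rw [← he M M J hJ k, ← he M M J hJ k, h]

/-- **A pull-back that is not the identity on de Rham cohomology is not the identity on singular
cohomology** (naturality and injectivity of `e_M`). [cite: Zucker1977, Appendix B p. 208] -/
theorem exists_singularCohomology_map_ne_of_deRham {e : ComplexDeRhamIsoFamily E}
    (he : e.IsNatural) {J : M → M} (hJ : ContMDiff 𝓘(ℝ, E) 𝓘(ℝ, E) ∞ J) {k : ℕ}
    (h : ∃ x : complexDeRhamCohomology E M k, complexDeRhamCohomology.map E hJ k x ≠ x) :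
    ∃ c : singularCohomology ℂ ℂ M k, singularCohomology.map ℂ ℂ ⟨J, hJ.continuous⟩ k c ≠ c := by
  obtain ⟨x, hx⟩ := h
  refine ⟨e M k x, fun h' ↦ hx ((e M k).injective ?_)⟩
  rw [he M M J hJ k]
  exact h'

/-- **The cohomological half of Zucker's argument, glued.** Let `e` be a natural complex de Rham
comparison family, `J : M → M` real `C^∞` with `J^* J^* = id` on `H²_dR(M; ℂ)` and with every
`(-1)`-eigenclass of `J^*` in `H²_dR(M; ℂ)` of type `(1,1)`. Then for every INTEGRAL class
`y ∈ H²(M; ℂ)` with `J^*y ≠ y`, the class `y - J^*y` is integral (pull-backs and differences of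
integral classes are integral), non-zero, and of type `(1,1)` (it is a `(-1)`-eigenclass:
`J^*(y - J^*y) = J^*y - y`). In Zucker's notation these are the classes of `H^{1,1}(T, ℤ)`, on
which `J^* = -1` (Appendix B, p. 208, `n = 1`). [cite: Zucker1977, Appendix B pp. 207–208] -/
theorem exists_integral_ne_zero_isOfTypeOnManifold_of_involutive {e : ComplexDeRhamIsoFamily E}
    (he : e.IsNatural) {J : M → M} (hJ : ContMDiff 𝓘(ℝ, E) 𝓘(ℝ, E) ∞ J)
    (h₁ : ∀ x : complexDeRhamCohomology E M 2,
      complexDeRhamCohomology.map E hJ 2 (complexDeRhamCohomology.map E hJ 2 x) = x)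
    (h₂ : ∀ x : complexDeRhamCohomology E M 2,
      complexDeRhamCohomology.map E hJ 2 x = -x → x ∈ hodgePQ E M 2 1 1)
    {y : singularCohomology ℂ ℂ M 2} (hy : IsIntegralClass y)
    (hJy : singularCohomology.map ℂ ℂ ⟨J, hJ.continuous⟩ 2 y ≠ y) :
    ∃ cls : singularCohomology ℂ ℂ M 2,
      IsIntegralClass cls ∧ cls ≠ 0 ∧ IsOfTypeOnManifold (E := E) 2 1 1 cls := by
  refine ⟨y - singularCohomology.map ℂ ℂ ⟨J, hJ.continuous⟩ 2 y, ?_,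
    sub_ne_zero.2 (Ne.symm hJy), ?_⟩
  · have h := hy.add ((hy.map ⟨J, hJ.continuous⟩).zsmul (-1))
    rwa [Int.cast_neg, Int.cast_one, neg_one_smul, ← sub_eq_add_neg] at h
  · refine IsOfTypeOnManifold.of_map_eq_smul he hJ (-1) (fun x hx ↦ h₂ x ?_) ?_
    · rwa [neg_one_smul] at hx
    · rw [map_sub, singularCohomology_map_map_of_deRham he hJ h₁, neg_one_smul, neg_sub]

end Transport

/-! ### The manifold half: the tree's complex tori -/

/-- **Reduction to the tree's complex tori.** A complex torus `T = ℂ²/Φ(ℤ^ι)`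
(`Literature.Geometry.Kaehler.ComplexTorus Φ`) is a compact connected Kähler surface charted on
`ℂ²` (`ComplexTorusKaehler`: the flat metric); so a non-zero integral class of type `(1,1)` on `T`
together with the absence of analytic hypersurfaces in `T` is a `ZuckerTorusWitness (Fin 2 → ℂ)`.
This is the shape of Zucker's example (a `J`-torus `ℂ²/L`). [cite: Zucker1977, Appendix B Theorem p. 208] -/
theorem Zucker1977_kaehlerTorus_noAnalyticCycles.of_complexTorus {ι : Type} [Fintype ι]
    (Φ : (ι → ℝ) ≃L[ℝ] (Fin 2 → ℂ))
    (cls : singularCohomology ℂ ℂ (ComplexTorus Φ) 2) (h₁ : IsIntegralClass cls) (h₂ : cls ≠ 0)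
    (h₃ : IsOfTypeOnManifold (E := Fin 2 → ℂ) 2 1 1 cls)
    (h₄ : ∀ Z : Set (ComplexTorus Φ), ¬ IsAnalyticHypersurface (E := Fin 2 → ℂ) Z) :
    Zucker1977_kaehlerTorus_noAnalyticCycles :=
  ⟨{ carrier := ComplexTorus Φ
     isKaehlerManifold := inferInstance
     cls := cls
     isIntegralClass := h₁
     cls_ne_zero := h₂
     isOfType := h₃
     no_analyticHypersurface := h₄ }⟩

end Literature.Barriers.HodgeConjecture

end
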